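import Summits.AtomisticToContinuum.HydrodynamicLimit.Theorems.BoxDissipativeWeakStrongRelativeEnergyStabilityGronwallIntegrableAlongB
import Summits.AtomisticToContinuum.HydrodynamicLimit.Theorems.BoxDissipativeWeakStrongRelativeEnergyStabilityCoerciveBoxHelpers
import HarnessLib

/-!
# Crux `RelativeEnergyStability` (stmt-AtomisticToContinuum-17653), line `registered`, heart stub S-X —
# helper package B: `x`-integrability of the five integrands at a fixed configuration (`sx_integrable_pieces`)

Registered sub-goal of the heart stub S-X (pathwise layer of the Březina–Feireisl bookkeeping): under the strong-side
conjunction `S` of `…GronwallStrong` (EOS fact data `(η₀, F)`, band `η₁ ≤ η₁B < η₀/2`, smooth band extension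
`eosB = EulerEOS.monatomicExcess χ f`, classical hard-sphere Euler solution `(ρ,u,θ)` on `[0,T)` with the guard
`ρσ³ ≤ η₁/2`), for ONE configuration `w` of `N+1` particles, a window `l`, clamps `a, b` and a time `s ∈ [0,T)`,
the five integrands of the bookkeeping are integrable over the torus in the box centre `x`:

1. the K1 (momentum-balance) integrand tested with `u`: `m̂·∂ₜu + Σᵢⱼ m̂ᵢm̂ⱼ/ρ̂ ∂ⱼuᵢ + ρ̂ θ̂ Z_cut(ρ̂σ³) div u`;
2. the K2 (entropy-balance) integrand tested with `θ`: `ρ̂ Z_{a,b}(ŝ) ∂ₜθ + Z_{a,b}(ŝ) m̂·∇θ`;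
3. the box continuity integrand tested with BF's `φ₁ = ½|u|² − μ_cut(ρ,θ)`: `ρ̂ ∂ₜφ₁ + m̂·∇φ₁`;
4. the divergence of the pressure flux of the strong solution, `p_cut div U + U·∇p_cut` (point data `pdAt`);
5. the clamped box relative energy `ℰ_{Z_{a,b}}(Û(w,x) | (ρ,u,θ)(s,x))`.

Proof. (1)–(3): for a FIXED box value `V = (ρ̂, m̂, Ê)` each integrand is continuous in `x` — the slices at time
`s ∈ [0,T)` of `u, ∂ₜu, ∂ⱼuᵢ, div u, ∂ₜθ, ∇θ, ∂ₜφ₁, ∇φ₁` are smooth torus functions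
(`IsSmoothSpaceTimeOn.isSmooth_slice`, `.timeDerivWithin`, `IsSmooth.partialDeriv/divergence/gradient`; `φ₁` is jointly
smooth by `sx_energyTest_smooth`) — and the box state `x ↦ Û(w,x)` takes finitely many values indexed by the measurable
occupancy pattern of the box, so `x ↦ G x (Û(w,x))` is measurable and bounded, hence integrable on the compact torus
(`ip_integrable_boxFun`, the argument of `co_integrable_clampedRelEnergy`). (4): along the solution the cut law has the
pressure and pressure gradient of `eosB` (`sx_pd_transfer`), whose coefficients `p, ∂ᵨp, ∂_θ p` are continuous on the open
quadrant (`IsGibbs`, `continuousOn_deriv_slice_fst/snd`); a continuous function on the compact torus is integrable.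
(5): `co_integrable_clampedRelEnergy` with the continuity of `x ↦ μ_cut(ρ,θ)(s,x)`, `p_cut(ρ,θ)(s,x)`
(`cc_continuousOn_chemPotential`, `tz_continuous_p` on the band-interior quadrant, `sx_band`).

References: BrezinaFeireisl2018 §3.1–3.2 (the bookkeeping these facts serve); measure theory only.
-/

noncomputable section

namespace Summit.AtomisticToContinuum.HydrodynamicLimit.Theorems.RES

open MeasureTheory Filter Set Function
open scoped Topology InnerProductSpace ENNReal
open Summit.AtomisticToContinuum.HydrodynamicLimit.Theses.BoxDissipativeWeakStrong
open Literature.MathematicalPhysics.KineticTheory Literature.Analysis.FluidPDE Literature.Analysis.FunctionSpaces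
open Literature.Analysis.FluidPDE.CompressibleEuler
open Literature.Analysis.FluidPDE.CompressibleEuler.EulerPhase
open Literature.Analysis.FluidPDE.CompressibleEuler.StrongPointData

/-- Integrability over the torus of `x ↦ G x (Û(w, x))` for one configuration `w`, when `x ↦ G x V` is continuous
for every box value `V`: the box state takes finitely many values, indexed by the (measurable) occupancy pattern of
the box, so the function is measurable and bounded (cf. `co_integrable_clampedRelEnergy`). -/
theorem ip_integrable_boxFun {N : ℕ} {l : ℝ} (w : Config (N + 1) (Fin 3) T3) {G : T3 → BoxState → ℝ}
    (hG : ∀ V, Continuous fun x => G x V) : Integrable fun x => G x (boxState l w x) := by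
  -- occupancy pattern and the finitely many values of the box state
  obtain ⟨occ, hocc⟩ : ∃ occ : T3 → (Fin (N + 1) → Bool),
      occ = fun x i => decide (∀ k, ‖(w i).1 k - x k‖ < l / 2) := ⟨_, rfl⟩
  obtain ⟨F, hF⟩ : ∃ F : (Fin (N + 1) → Bool) → BoxState, F = fun o =>
      (((N + 1 : ℕ) : ℝ)⁻¹ * ∑ i, (if o i = true then (l ^ 3)⁻¹ else 0),
        ((N + 1 : ℕ) : ℝ)⁻¹ • ∑ i, (if o i = true then (l ^ 3)⁻¹ else (0 : ℝ)) • (w i).2,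
        ((N + 1 : ℕ) : ℝ)⁻¹ * ∑ i, (if o i = true then (l ^ 3)⁻¹ else 0) * (‖(w i).2‖ ^ 2 / 2)) :=
    ⟨_, rfl⟩
  have hrepr : ∀ x, boxState l w x = F (occ x) := by
    intro x
    simp only [hF, hocc, boxState, empiricalDensityField_eq_sum, empiricalMomentumField_eq_sum,
      empiricalEnergyField_eq_sum, boxKernel, Set.indicator_apply, Set.mem_setOf_eq, decide_eq_true_eq]
  have hoccm : Measurable occ := by
    rw [hocc]
    refine measurable_pi_lambda _ fun i => measurable_to_bool ?_
    have hset : (fun x : T3 => decide (∀ k, ‖(w i).1 k - x k‖ < l / 2)) ⁻¹' {true} =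
        ⋂ k, {x : T3 | ‖(w i).1 k - x k‖ < l / 2} := by
      ext x; simp
    rw [hset]
    exact (isOpen_iInter_of_finite fun k => isOpen_lt (by fun_prop) continuous_const).measurableSet
  -- measurability
  have hmeas : Measurable fun x => G x (boxState l w x) := by
    have h1 : (fun x => G x (boxState l w x)) =
        (fun p : T3 × (Fin (N + 1) → Bool) => G p.1 (F p.2)) ∘ fun x => (x, occ x) := by
      funext x; simp only [Function.comp_apply, hrepr x]
    rw [h1]
    exact (measurable_from_prod_countable_left fun o => (hG (F o)).measurable).comp
      (measurable_id.prodMk hoccm)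
  -- a uniform bound
  have hbd : ∀ o : Fin (N + 1) → Bool, ∃ B : ℝ, ∀ x, |G x (F o)| ≤ B := by
    intro o
    obtain ⟨B, hB⟩ := isCompact_univ.exists_bound_of_continuousOn (hG (F o)).continuousOn
    exact ⟨B, fun x => Real.norm_eq_abs _ ▸ hB x (mem_univ x)⟩
  choose B hB using hbd
  refine (integrable_const (∑ o, |B o|)).mono' hmeas.aestronglyMeasurable (ae_of_all _ fun x => ?_)
  rw [Real.norm_eq_abs, hrepr x]
  exact ((hB (occ x) x).trans (le_abs_self _)).trans
    (Finset.single_le_sum (fun o _ => abs_nonneg (B o)) (Finset.mem_univ (occ x)))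

/-- **(B1) `sx_integrable_pieces`.** At a fixed configuration `w`, window `l > 0`, clamps `a, b` and time `s ∈ [0,T)`,
the five `x`-integrands of the pathwise bookkeeping are integrable over the torus: the K1 (momentum) integrand tested
with `u`, the K2 (entropy) integrand tested with `θ`, the box continuity integrand tested with `φ₁`, the divergence of
the pressure flux of the strong solution, and the clamped box relative energy. -/
theorem sx_integrable_pieces {η₀ η₁ η₁B σ T : ℝ} {F χ f : ℝ → ℝ} {ρ θ : ℝ → T3 → ℝ} {u : ℝ → T3 → V3}
    (S : AnalyticOnNhd ℝ F (Ioo (-η₀) η₀) ∧ EqOn hsExcessFreeEnergy F (Ico 0 η₀) ∧ 0 < η₁ ∧ η₁ ≤ η₁B ∧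
      2 * η₁B < η₀ ∧ 0 < σ ∧
      (∀ x, 0 < x → x * σ ^ 3 ≤ η₁B → f x = hsExcessFreeEnergy (x * σ ^ 3) ∧ χ x = hsCompressibility (x * σ ^ 3)) ∧
      (EulerEOS.monatomicExcess χ f).IsGibbs ∧ IsHardSphereEulerSolution σ T ρ u θ ∧
      ∀ t ∈ Ico 0 T, ∀ x, ρ t x * σ ^ 3 ≤ η₁ / 2)
    {N : ℕ} (w : Config (N + 1) (Fin 3) T3) {l : ℝ} (hl : 0 < l) (a b : ℝ) {s : ℝ} (hs : s ∈ Ico 0 T) :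
    Integrable (fun x => inner ℝ (boxState l w x).2.1 (Torus.timeDerivWithin (Ico 0 T) u s x) +
        (∑ i, ∑ j, (boxState l w x).2.1 i * (boxState l w x).2.1 j / (boxState l w x).1 *
          Torus.partialDeriv j (fun y => u s y i) x) +
        (boxState l w x).1 * (2 / 3 * ((boxState l w x).2.2 / (boxState l w x).1 -
          ‖(boxState l w x).2.1‖ ^ 2 / (2 * (boxState l w x).1 ^ 2))) * cutCompressibility η₁ ((boxState l w x).1 * σ ^ 3) *
          Torus.divergence (u s) x) ∧
    Integrable (fun x => (boxState l w x).1 *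
            max a (min ((cutEOS σ η₁).s (boxState l w x).1
              (2 / 3 * ((boxState l w x).2.2 / (boxState l w x).1 -
                ‖(boxState l w x).2.1‖ ^ 2 / (2 * (boxState l w x).1 ^ 2)))) b) *
          Torus.timeDerivWithin (Ico 0 T) θ s x +
        max a (min ((cutEOS σ η₁).s (boxState l w x).1
              (2 / 3 * ((boxState l w x).2.2 / (boxState l w x).1 -
                ‖(boxState l w x).2.1‖ ^ 2 / (2 * (boxState l w x).1 ^ 2)))) b) *
          inner ℝ (boxState l w x).2.1 (Torus.gradient (θ s) x)) ∧
    Integrable (fun x => (boxState l w x).1 *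
          Torus.timeDerivWithin (Ico 0 T) (energyTestFunction (cutEOS σ η₁) ρ u θ) s x +
        inner ℝ (boxState l w x).2.1 (Torus.gradient (energyTestFunction (cutEOS σ η₁) ρ u θ s) x)) ∧
    Integrable (fun x => (cutEOS σ η₁).p (pdAt T ρ u θ (s, x)).r (pdAt T ρ u θ (s, x)).Θ * (pdAt T ρ u θ (s, x)).divU +
        ∑ j, (pdAt T ρ u θ (s, x)).U j * (pdAt T ρ u θ (s, x)).gp (cutEOS σ η₁) j) ∧
    Integrable (fun x => clampedRelEnergy σ η₁ a b (ρ s x) (u s x) (θ s x) (boxState l w x)) := by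
  have _ := hl -- (registered signature; positivity of the window is not needed at a fixed configuration)
  have hsol : IsHardSphereEulerSolution σ T ρ u θ := S.2.2.2.2.2.2.2.2.1
  have hGB : (EulerEOS.monatomicExcess χ f).IsGibbs := S.2.2.2.2.2.2.2.1
  have hη₁ : 0 < η₁ := S.2.2.1
  have hσ : 0 < σ := S.2.2.2.2.2.1
  have hη₁₀ : η₁ < η₀ := sx_band_lt S
  have hS : UniqueDiffOn ℝ (Ico 0 T) := uniqueDiffOn_Ico 0 T
  -- continuity of the strong slices and of their derivatives at time `s`
  have su : Torus.IsSmooth (u s) := hsol.smooth_velocity.isSmooth_slice hs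
  have sρ : Torus.IsSmooth (ρ s) := hsol.smooth_density.isSmooth_slice hs
  have sθ : Torus.IsSmooth (θ s) := hsol.smooth_temperature.isSmooth_slice hs
  have cu : Continuous (u s) := su.continuous
  have cρ : Continuous (ρ s) := sρ.continuous
  have cθ : Continuous (θ s) := sθ.continuous
  have cut : Continuous (Torus.timeDerivWithin (Ico 0 T) u s) :=
    ((hsol.smooth_velocity.timeDerivWithin hS).isSmooth_slice hs).continuous
  have cθt : Continuous (Torus.timeDerivWithin (Ico 0 T) θ s) :=
    ((hsol.smooth_temperature.timeDerivWithin hS).isSmooth_slice hs).continuous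
  have cuij : ∀ i j, Continuous (Torus.partialDeriv j (fun y => u s y i)) := fun i j =>
    ((su.apply i).partialDeriv j).continuous
  have cdiv : Continuous (Torus.divergence (u s)) := su.divergence.continuous
  have cgθ : Continuous (Torus.gradient (θ s)) := sθ.gradient.continuous
  have cφt : Continuous (Torus.timeDerivWithin (Ico 0 T) (energyTestFunction (cutEOS σ η₁) ρ u θ) s) :=
    (((sx_energyTest_smooth S).timeDerivWithin hS).isSmooth_slice hs).continuous
  have cgφ : Continuous (Torus.gradient (energyTestFunction (cutEOS σ η₁) ρ u θ s)) :=
    ((sx_energyTest_smooth S).isSmooth_slice hs).gradient.continuous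
  -- the thermal state of the strong solution at time `s` lies in the band-interior quadrant
  have hpair : Continuous fun x => (ρ s x, θ s x) := cρ.prodMk cθ
  have hmaps : ∀ x, (ρ s x, θ s x) ∈ Ioi (0 : ℝ) ×ˢ Ioi (0 : ℝ) := fun x =>
    ⟨((sx_band S) hs x).1, ((sx_band S) hs x).2.2⟩
  refine ⟨?_, ?_, ?_, ?_, ?_⟩
  · -- K1 integrand
    exact ip_integrable_boxFun w
      (G := fun x V => inner ℝ V.2.1 (Torus.timeDerivWithin (Ico 0 T) u s x) +
        (∑ i, ∑ j, V.2.1 i * V.2.1 j / V.1 * Torus.partialDeriv j (fun y => u s y i) x) +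
        V.1 * (2 / 3 * (V.2.2 / V.1 - ‖V.2.1‖ ^ 2 / (2 * V.1 ^ 2))) * cutCompressibility η₁ (V.1 * σ ^ 3) *
          Torus.divergence (u s) x)
      fun V => by fun_prop
  · -- K2 integrand
    exact ip_integrable_boxFun w
      (G := fun x V => V.1 * max a (min ((cutEOS σ η₁).s V.1 (2 / 3 * (V.2.2 / V.1 - ‖V.2.1‖ ^ 2 / (2 * V.1 ^ 2)))) b) *
          Torus.timeDerivWithin (Ico 0 T) θ s x +
        max a (min ((cutEOS σ η₁).s V.1 (2 / 3 * (V.2.2 / V.1 - ‖V.2.1‖ ^ 2 / (2 * V.1 ^ 2)))) b) *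
          inner ℝ V.2.1 (Torus.gradient (θ s) x))
      fun V => by fun_prop
  · -- continuity integrand tested with `φ₁`
    exact ip_integrable_boxFun w
      (G := fun x V => V.1 * Torus.timeDerivWithin (Ico 0 T) (energyTestFunction (cutEOS σ η₁) ρ u θ) s x +
        inner ℝ V.2.1 (Torus.gradient (energyTestFunction (cutEOS σ η₁) ρ u θ s) x))
      fun V => by fun_prop
  · -- divergence of the pressure flux: continuous in `x` (coefficients of the smooth band extension)
    have cp : Continuous fun x => (EulerEOS.monatomicExcess χ f).p (ρ s x) (θ s x) :=
      hGB.1.continuousOn.comp_continuous hpair hmaps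
    have cpρ : Continuous fun x => deriv (fun r => (EulerEOS.monatomicExcess χ f).p r (θ s x)) (ρ s x) :=
      (continuousOn_deriv_slice_fst hGB.1 isOpen_quadrant le_rfl).comp_continuous hpair hmaps
    have cpϑ : Continuous fun x => deriv (fun τ => (EulerEOS.monatomicExcess χ f).p (ρ s x) τ) (θ s x) :=
      (continuousOn_deriv_slice_snd hGB.1 isOpen_quadrant le_rfl).comp_continuous hpair hmaps
    have cuj : ∀ j, Continuous fun x => u s x j := fun j => (su.apply j).continuous
    have cgρj : ∀ j, Continuous fun x => Torus.gradient (ρ s) x j := fun j => (sρ.gradient.apply j).continuous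
    have cgθj : ∀ j, Continuous fun x => Torus.gradient (θ s) x j := fun j => (sθ.gradient.apply j).continuous
    have c4 : Continuous fun x => (EulerEOS.monatomicExcess χ f).p (pdAt T ρ u θ (s, x)).r (pdAt T ρ u θ (s, x)).Θ *
          (pdAt T ρ u θ (s, x)).divU +
        ∑ j, (pdAt T ρ u θ (s, x)).U j * (pdAt T ρ u θ (s, x)).gp (EulerEOS.monatomicExcess χ f) j := by
      show Continuous fun x => (EulerEOS.monatomicExcess χ f).p (ρ s x) (θ s x) *
          (∑ i, Torus.partialDeriv i (fun y => u s y i) x) +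
        ∑ j, u s x j * (deriv (fun r => (EulerEOS.monatomicExcess χ f).p r (θ s x)) (ρ s x) *
            Torus.gradient (ρ s) x j +
          deriv (fun τ => (EulerEOS.monatomicExcess χ f).p (ρ s x) τ) (θ s x) * Torus.gradient (θ s) x j)
      exact (cp.mul (continuous_finsetSum _ fun i _ => cuij i i)).add
        (continuous_finsetSum _ fun j _ => (cuj j).mul (((cpρ.mul (cgρj j))).add (cpϑ.mul (cgθj j))))
    refine (c4.integrable_of_hasCompactSupport (HasCompactSupport.of_compactSpace _)).congr
      (ae_of_all _ fun x => ?_)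
    obtain ⟨hp, -, -, -, -, -, -, -, hgp⟩ := (sx_pd_transfer S) hs x
    simp only [hp, hgp]
  · -- the clamped box relative energy
    have hμC : Continuous fun x => (cutEOS σ η₁).chemPotential (ρ s x) (θ s x) :=
      (cc_continuousOn_chemPotential S.1 S.2.1 hη₁ hη₁₀ hσ).comp_continuous hpair hmaps
    have hpC : Continuous fun x => (cutEOS σ η₁).p (ρ s x) (θ s x) :=
      tz_continuous_p S.1 S.2.1 hη₁ hη₁₀ hσ cρ cθ fun x => ((sx_band S) hs x).1
    exact co_integrable_clampedRelEnergy cu cθ hμC hpC w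

end Summit.AtomisticToContinuum.HydrodynamicLimit.Theorems.RES

end
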